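import Summits.CriticalPhenomena.Ising3DConformalLimit.Theses.GaussianScaleMixture
import Summits.CriticalPhenomena.Ising3DConformalLimit.Theses.HyperoctahedralRP
import Summits.CriticalPhenomena.Ising3DConformalLimit.Theorems.MoebiusLimitExists.Negative.FreeReflections
import Summits.CriticalPhenomena.Ising3DConformalLimit.Theorems.MoebiusLimitExists.Negative.MeshContinuity
import Summits.CriticalPhenomena.Ising3DConformalLimit.Theorems.GaussianScaleMixtureRotationUpgradeFromTwoPointHexEmbedding
import Summits.CriticalPhenomena.Ising3DConformalLimit.Theorems.GaussianScaleMixtureRotationUpgradeFromTwoPointHexPlusStateSixfold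
import Summits.CriticalPhenomena.Ising3DConformalLimit.Theorems.GaussianScaleMixtureRotationUpgradeFromTwoPointLatticeSymmetryTransport
import Summits.CriticalPhenomena.Ising3DConformalLimit.Theorems.GaussianScaleMixtureRotationUpgradeFromTwoPointArccosQuarter
import Summits.CriticalPhenomena.Ising3DConformalLimit.Theorems.GaussianScaleMixtureRotationUpgradeFromTwoPointTwistIdentities
import Summits.CriticalPhenomena.Ising3DConformalLimit.Theorems.GaussianScaleMixtureRotationUpgradeFromTwoPointCircleClosed
import Summits.CriticalPhenomena.Ising3DConformalLimit.Theorems.GaussianScaleMixtureRotationUpgradeFromTwoPointRotationsFromTwoCircles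
import Literature.Probability.LatticeModels.StackedTriangularIsing
import HarnessLib

/-!
# Crux `RotationUpgradeFromTwoPoint` (stmt-CriticalPhenomena-8367), line `two-crystals-generate-so3`:
# the reduction to the universality bridge (CONDITIONAL theorems; bridge as hypothesis)

THEOREM-ONLY file. The line `two-crystals-generate-so3` (skeleton
`Cruxes/RotationUpgradeFromTwoPoint/Lines/two-crystals-generate-so3.lean`, lead
prover-line-stmt-CriticalPhenomena-8367-0) reduces the crux to ONE open statement, the universality
bridge (U_hex) in symmetric gauge — "every normalised non-degenerate pointwise scaling limit `S` of the
critical `ℤ³` correlators is, after renormalisation and the explicit equilateral embedding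
`L_c (v₀,v₁,v₂) = (v₀ + v₁/2, (√3/2)v₁, c v₂)` (free axial scale `c > 0`), also the pointwise scaling
limit of the critical stacked-triangular correlators `stackedTriCriticalCorr`" — and this file lands
the reduction itself as theorems with the bridge as an explicit hypothesis `hU`:

* `isRotationInvariant_of_hexBridge` : `hU →` every normalised non-degenerate pointwise scaling limit
  of `criticalCorr 3` is `IsRotationInvariant` — NO two-point isotropy, translation or scale
  hypothesis is needed (in the symmetric gauge the transported sixfold map is the isometry `R_z(60°)`
  on the nose);
* `rotationUpgradeFromTwoPoint_of_hexBridge` : `hU → RotationUpgradeFromTwoPoint` (the crux of route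
  GaussianScaleMixture, item stmt-CriticalPhenomena-8367);
* `limitRotationInvariant_of_hexBridge` : `hU → LimitRotationInvariant` (the crux of route
  HyperoctahedralRP, item stmt-CriticalPhenomena-1980, whose own hypothesis `HRP2Rigidity` is then
  not needed).

Ingredients, all landed: the six registered stubs of the line (`stub_hexPlusStateSixfold`,
`stub_latticeSymmetryTransport`, `stub_arccosQuarter`, `stub_twistIdentities`, `stub_circleClosed`,
`stub_rotationsFromTwoCircles`), the explicit isometries and the hex embedding
(`…Isometries.lean`, `…HexEmbedding.lean`), the free `B₃` symmetry and continuity of any limit of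
`criticalCorr 3` (tree: `limit_coordPerm`, `limit_signFlip`, `continuousOn_limit`), and the
stacked-triangular vocabulary (`Literature/Probability/LatticeModels/StackedTriangularIsing.lean`).
Chain: bridge ⇒ `S ∘ L_c` is the `T`-limit ⇒ (exact `M̃`-symmetry of the `T` plus state + transport)
`S` is invariant under `L_c M̃ L_c⁻¹ = R_z(60°)` ⇒ with `B₃`: `R_z(30°)` and
`N = R_z(30°)R_x(90°)R_z(30°) = W R_z(arccos(-1/4)) W` ⇒ (irrational angle, closed invariance group)
the circle `W R_z(φ) W` ⇒ (conjugation by `(x,y,z) ↦ (-z,y,x)`) the circle `W R_x(φ) W` ⇒ (two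
circles + one coordinate reflection, Cartan–Dieudonné) `O(3)`.
References: Cardy 1996 §3 (anisotropic scaling); Duminil-Copin–Kozlowski–Krachun–Manolescu–Oulamara,
arXiv:2012.11672 (planar precedent); Di Francesco–Mathieu–Sénéchal 1997 §4.1.
-/

noncomputable section

open Literature.Probability.LatticeModels Finset Filter
open Summit.CriticalPhenomena.Ising3DConformalLimit

namespace Summit.CriticalPhenomena.Ising3DConformalLimit.Cruxes.RotationUpgradeFromTwoPoint.TwoCrystalsGenerateSo3

/-- **The reduction.** Assume the universality bridge (U_hex) in symmetric gauge (`hU`). Then every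
normalised, non-degenerate pointwise scaling limit `S` of the critical `ℤ³` correlators is invariant
under every linear isometry of `ℝ³`, at every order and every configuration. No two-point isotropy,
translation invariance or scale covariance is assumed. [folklore] -/
theorem isRotationInvariant_of_hexBridge :
    (∀ (ρ : ℝ → ℝ) (S : CorrFamily 3), (∀ δ ∈ Set.Ioc (0:ℝ) 1, 0 < ρ δ) →
      HasPointwiseScalingLimit (criticalCorr 3) ρ S →
      (∀ n z, z ∉ NonCoincident 3 n → S n z = 0) → IsNondegenerateTwoPoint S →
      ∃ (ρ' : ℝ → ℝ) (c : ℝ), (∀ δ ∈ Set.Ioc (0:ℝ) 1, 0 < ρ' δ) ∧ 0 < c ∧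
        HasPointwiseScalingLimit stackedTriCriticalCorr ρ'
          (fun n x => S n (fun i => WithLp.toLp 2
            ![(x i) 0 + (x i) 1 / 2, Real.sqrt 3 / 2 * (x i) 1, c * (x i) 2]))) →
    ∀ (ρ : ℝ → ℝ) (S : CorrFamily 3), (∀ δ ∈ Set.Ioc (0:ℝ) 1, 0 < ρ δ) →
      HasPointwiseScalingLimit (criticalCorr 3) ρ S →
      (∀ n z, z ∉ NonCoincident 3 n → S n z = 0) → IsNondegenerateTwoPoint S →
      IsRotationInvariant S := by
  intro hU ρ S h1 h2 h3 h4
  -- free structure of any limit of `criticalCorr 3`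
  have hcont : ∀ n, ContinuousOn (S n) (NonCoincident 3 n) := fun n =>
    LimitMeshContinuity.continuousOn_limit h2 n
  have hperm : ∀ (π : Equiv.Perm (Fin 3)) (n : ℕ) (x : Fin n → EuclideanSpace ℝ (Fin 3)),
      S n (fun i => LinearIsometryEquiv.piLpCongrLeft 2 ℝ ℝ π (x i)) = S n x := by
    intro π n x
    by_cases hx : x ∈ NonCoincident 3 n
    · exact MoebiusLimitExistsNegative.limit_coordPerm h2 π hx
    · rw [h3 n x hx,
        h3 n _ (mt (MoebiusLimitExistsNegative.map_mem_nonCoincident_iff _ x).1 hx)]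
  have hflip : ∀ (ε : Fin 3 → ℤˣ) (R : EuclideanSpace ℝ (Fin 3) ≃ₗᵢ[ℝ] EuclideanSpace ℝ (Fin 3)),
      (∀ (p : EuclideanSpace ℝ (Fin 3)) (j : Fin 3), R p j = ((ε j : ℤ) : ℝ) * p j) →
      ∀ (n : ℕ) (x : Fin n → EuclideanSpace ℝ (Fin 3)), S n (fun i => R (x i)) = S n x := by
    intro ε R hR n x
    by_cases hx : x ∈ NonCoincident 3 n
    · exact MoebiusLimitExistsNegative.limit_signFlip h2 ε R hR hx
    · rw [h3 n x hx,
        h3 n _ (mt (MoebiusLimitExistsNegative.map_mem_nonCoincident_iff R x).1 hx)]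
  have hsigned : ∀ π ε, Inv S (signedIso π ε) := inv_signedIso hperm hflip
  -- the bridge, symmetric gauge
  obtain ⟨ρ', c, _hρ', hc, hlim'⟩ := hU ρ S h1 h2 h3 h4
  have hc0 : c ≠ 0 := hc.ne'
  set L := hexEmbed c hc0 with hL
  set S' : CorrFamily 3 := fun n x => S n (fun i => L (x i)) with hS'
  have hlimL : HasPointwiseScalingLimit stackedTriCriticalCorr ρ' S' := by
    have : S' = fun n x => S n (fun i => WithLp.toLp 2
        ![(x i) 0 + (x i) 1 / 2, Real.sqrt 3 / 2 * (x i) 1, c * (x i) 2]) := by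
      funext n x
      simp only [hS', hL, hexEmbed_apply]
    rw [this]; exact hlim'
  have hmapL : ∀ (n : ℕ) (x : Fin n → EuclideanSpace ℝ (Fin 3)),
      (fun i => L (x i)) ∈ NonCoincident 3 n ↔ x ∈ NonCoincident 3 n := by
    intro n x
    rw [mem_nonCoincident, mem_nonCoincident]
    exact L.injective.of_comp_iff x
  have hcont' : ∀ n, ContinuousOn (S' n) (NonCoincident 3 n) := by
    intro n
    have hΦ : Continuous (fun (x : Fin n → EuclideanSpace ℝ (Fin 3)) (i : Fin n) => L (x i)) :=
      continuous_pi fun i => L.continuous.comp (continuous_apply i)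
    exact (hcont n).comp hΦ.continuousOn (fun x hx => (hmapL n x).2 hx)
  -- the `T`-correlators are exactly `M̃`-invariant (finite lattice)
  have hGsix : ∀ (n : ℕ) (k : Fin n → Site 3),
      stackedTriCriticalCorr n (fun i => stackedTriSixfold.mulVec (k i)) = stackedTriCriticalCorr n k := by
    intro n k
    exact stub_hexPlusStateSixfold stackedTriGraph stackedTriGraph_adj_iff_bond stackedTriCriticalBeta
      stackedTriCriticalBeta_nonneg n k
  -- transport to the limit
  have hsix : ∀ (n : ℕ) (x : Fin n → EuclideanSpace ℝ (Fin 3)), x ∈ NonCoincident 3 n →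
      S' n (fun i => zlin stackedTriSixfold (x i)) = S' n x :=
    stub_latticeSymmetryTransport 3 stackedTriCriticalCorr ρ' S' stackedTriSixfold stackedTriSixfoldInv
      stackedTriSixfold_mul_inv stackedTriSixfoldInv_mul hGsix hlimL hcont'
  -- hence `S` is invariant under `R_z(60°) = L M̃ L⁻¹` everywhere
  have hrz60 : Inv S rz60 := by
    intro n x
    by_cases hx : x ∈ NonCoincident 3 n
    · have hy : (fun i => L.symm (x i)) ∈ NonCoincident 3 n := by
        rw [mem_nonCoincident] at hx ⊢
        exact L.symm.injective.comp hx
      have key := hsix n (fun i => L.symm (x i)) hy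
      simp only [hS'] at key
      simp only [ContinuousLinearEquiv.apply_symm_apply] at key
      have hcfg : (fun i => L (zlin stackedTriSixfold (L.symm (x i)))) = fun i => rz60 (x i) := by
        funext i; exact hexEmbed_conj_sixfold c hc0 (x i)
      rw [hcfg] at key
      exact key
    · rw [h3 n x hx, h3 n _ (mt (MoebiusLimitExistsNegative.map_mem_nonCoincident_iff rz60 x).1 hx)]
  -- the explicit element `N = R_z(30°) R_x(90°) R_z(30°)` and the circle `T φ = W R_z(φ) W`
  have hrz30 : Inv S (fun x => rz60 (rz60 (rzNeg90 x))) :=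
    (hrz60.comp hrz60).comp (hsigned _ _)
  have hN : Inv S (fun x => rz60 (rz60 (rzNeg90 (rx90 (rz60 (rz60 (rzNeg90 x))))))) :=
    (hrz30.comp (hsigned _ _)).comp hrz30
  obtain ⟨htw1, htw2⟩ := stub_twistIdentities frameW (fun x => rz60 (rz60 (rzNeg90 x))) rx90
    (rotZ (Real.arccos (-1 / 4))) rc rc.symm (fun φ x => rotZ φ x) (fun φ x => rotX φ x)
    frameW_apply rz30_apply rx90_apply
    (by
      intro x
      rw [rotZ_apply, Real.cos_arccos (by norm_num) (by norm_num), Real.sin_arccos]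
      have : Real.sqrt (1 - (-1 / 4) ^ 2) = Real.sqrt 15 / 4 := by
        rw [show (1 : ℝ) - (-1 / 4) ^ 2 = 15 / 16 by norm_num, Real.sqrt_div' _ (by norm_num : (0:ℝ) ≤ 16)]
        rw [show (16 : ℝ) = 4 ^ 2 by norm_num, Real.sqrt_sq (by norm_num)]
      rw [this]
      ext j; fin_cases j <;> simp <;> ring)
    rc_apply rc_symm_apply rotZ_apply rotX_apply
  have hTθ₀ : Inv S (circleZ (Real.arccos (-1 / 4))) := by
    refine hN.congr fun x => ?_
    rw [circleZ_apply, htw1 x]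
  -- the whole circle
  have hcircZ : ∀ φ, Inv S (circleZ φ) := by
    intro φ n x
    exact stub_circleClosed S circleZ (Real.arccos (-1 / 4)) hcont h3 circleZ_add continuous_circleZ
      circleZ_two_pi stub_arccosQuarter hTθ₀ φ n x
  -- the conjugate circle `W R_x(φ) W = R_c (W R_z(φ) W) R_c⁻¹`
  have hcircX : ∀ φ, Inv S (circleX φ) := by
    intro φ
    have h := ((hsigned (Equiv.swap 0 2) ![-1, 1, 1]).comp (hcircZ φ)).comp
      (hsigned (Equiv.swap 0 2) ![-1, 1, 1]).symm
    refine h.congr fun x => ?_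
    show rc (circleZ φ (rc.symm x)) = circleX φ x
    rw [circleZ_apply, circleX_apply]
    exact htw2 φ x
  -- two circles + one reflection ⇒ O(3)
  refine stub_rotationsFromTwoCircles (fun φ x => rotZ φ x) (fun φ x => rotX φ x) rotZ_apply rotX_apply
    S frameW ?_ ?_ ?_
  · intro φ
    refine ⟨circleZ φ, fun x => ?_, hcircZ φ⟩
    rw [circleZ_apply, frameW_frameW]
  · intro φ
    refine ⟨circleX φ, fun x => ?_, hcircX φ⟩
    rw [circleX_apply, frameW_frameW]
  · exact ⟨flip0, flip0_apply, hsigned 1 ![-1, 1, 1]⟩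

/-- **The crux of route GaussianScaleMixture follows from the bridge**: (U_hex) in symmetric gauge
implies `RotationUpgradeFromTwoPoint` (its hypotheses (H5)–(H7) — translation invariance, scale
covariance, two-point isotropy — are not even needed). [folklore] -/
theorem rotationUpgradeFromTwoPoint_of_hexBridge :
    (∀ (ρ : ℝ → ℝ) (S : CorrFamily 3), (∀ δ ∈ Set.Ioc (0:ℝ) 1, 0 < ρ δ) →
      HasPointwiseScalingLimit (criticalCorr 3) ρ S →
      (∀ n z, z ∉ NonCoincident 3 n → S n z = 0) → IsNondegenerateTwoPoint S →
      ∃ (ρ' : ℝ → ℝ) (c : ℝ), (∀ δ ∈ Set.Ioc (0:ℝ) 1, 0 < ρ' δ) ∧ 0 < c ∧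
        HasPointwiseScalingLimit stackedTriCriticalCorr ρ'
          (fun n x => S n (fun i => WithLp.toLp 2
            ![(x i) 0 + (x i) 1 / 2, Real.sqrt 3 / 2 * (x i) 1, c * (x i) 2]))) →
    Theses.GaussianScaleMixture.RotationUpgradeFromTwoPoint :=
  fun hU ρ _ S h1 h2 h3 h4 _ _ _ => isRotationInvariant_of_hexBridge hU ρ S h1 h2 h3 h4

/-- **The crux of route HyperoctahedralRP follows from the same bridge**: (U_hex) in symmetric gauge
implies `LimitRotationInvariant` (item stmt-CriticalPhenomena-1980), without using its own hypothesis
`HRP2Rigidity`. [folklore] -/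
theorem limitRotationInvariant_of_hexBridge :
    (∀ (ρ : ℝ → ℝ) (S : CorrFamily 3), (∀ δ ∈ Set.Ioc (0:ℝ) 1, 0 < ρ δ) →
      HasPointwiseScalingLimit (criticalCorr 3) ρ S →
      (∀ n z, z ∉ NonCoincident 3 n → S n z = 0) → IsNondegenerateTwoPoint S →
      ∃ (ρ' : ℝ → ℝ) (c : ℝ), (∀ δ ∈ Set.Ioc (0:ℝ) 1, 0 < ρ' δ) ∧ 0 < c ∧
        HasPointwiseScalingLimit stackedTriCriticalCorr ρ'
          (fun n x => S n (fun i => WithLp.toLp 2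
            ![(x i) 0 + (x i) 1 / 2, Real.sqrt 3 / 2 * (x i) 1, c * (x i) 2]))) →
    Theses.HyperoctahedralRP.LimitRotationInvariant :=
  fun hU _ ρ _ S h1 h2 h3 h4 _ _ => isRotationInvariant_of_hexBridge hU ρ S h1 h2 h3 h4

end Summit.CriticalPhenomena.Ising3DConformalLimit.Cruxes.RotationUpgradeFromTwoPoint.TwoCrystalsGenerateSo3

end
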